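import Summits.Ventures.YMGap.RobustBall.LoopActivity
import HarnessLib

/-!
# RobustBall/TermPerturbation — a ball member assembled from a finite family of local terms, and its loads
(cell `pub-ymgap`, track Y2 ROBUST-BALL, T0.2 witnesses; p1)

HONEST FRAMING: elementary finite-torus bookkeeping (no probability, no continuum, no Clay claim). A LOCAL TERM
(`LocalTerm`) is a gauge-invariant, measurable, bounded activity reading a list of LETTERS (links, with multiplicity)
based in a polymer `code`, with single-link oscillation witness `oscC · mult` and Frobenius-Lipschitz witness
`lipC · mult`; the loop activity `τ(1 − Re tr U_w/N)` of a closed word is one (`LocalTerm.ofLoop`), products of loop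
traces are others (`RobustBall/ParallelPairWitness`). Given a finite family `T : ι → LocalTerm d L N`, the perturbation
`termPerturbation T` puts on the polymer `X` the sum of the activities of the terms with `code r = X`. We prove:
* it IS a `Perturbation d L N` (local, gauge invariant, measurable, bounded) with `total = Σ_r act_r`;
* `HasRange R` when every code has diameter `≤ R`;
* the LOAD WITNESS `termLoadWitness` (per-polymer sums of the one-link witnesses) and the load formulas under the
  tree's SITE incidence (`polymersThroughEdge e` = polymers containing the base site `e.1`, the landed convention;
  rb-theory ruling 2026-08-22T20:54Z): `oscLoad 0 e = Σ_r oscC_r · mult_r(e)`,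
  `selfLipLoad 0 e + crossLipLoad 0 e = Σ_{r : e.1 ∈ code r} lipC_r · |letters_r|` (ALL terms whose polymer contains
  the SITE `e.1` are charged) — hence `ClusterDomainFR` membership from two counting bounds;
* `HasVertRange m` from an injective code and per-term vertical windows; centre-slab invariance of the total from
  centre-invariant terms; hence `IsSlabLocal m`.
-/

noncomputable section

open MeasureTheory Finset Function
open Literature.Probability.LatticeModels Literature.Probability.LatticeModels.DobrushinMetric
open Literature.MathematicalPhysics.QuantumLattice hiding torusNorm
open Literature.MathematicalPhysics.QuantumFieldTheory hiding ZdEdge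

namespace Summit.Ventures.YMGap.RobustBall

variable {d L N : ℕ} {ι : Type*}

/-! ### Sums of one-link witnesses -/

/-- Oscillation witnesses add up over finite sums. [folklore] -/
theorem isOscBound_sum {V S : Type*} (s : Finset ι) {f : ι → (V → S) → ℝ} {δ : ι → V → ℝ}
    (h : ∀ i ∈ s, Dobrushin.IsOscBound (f i) (δ i)) :
    Dobrushin.IsOscBound (fun σ => ∑ i ∈ s, f i σ) fun y => ∑ i ∈ s, δ i y := by
  refine ⟨fun y => sum_nonneg fun i hi => (h i hi).nonneg y, fun y σ τ hστ => ?_⟩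
  rw [← sum_sub_distrib]
  exact (abs_sum_le_sum_abs _ _).trans (sum_le_sum fun i hi => (h i hi).le y σ τ hστ)

/-- Lipschitz witnesses add up over finite sums. [folklore] -/
theorem isLipBound_sum {V S : Type*} {ρ : S → S → ℝ} (s : Finset ι) {f : ι → (V → S) → ℝ} {δ : ι → V → ℝ}
    (h : ∀ i ∈ s, IsLipBound ρ (f i) (δ i)) :
    IsLipBound ρ (fun σ => ∑ i ∈ s, f i σ) fun y => ∑ i ∈ s, δ i y := by
  refine ⟨fun y => sum_nonneg fun i hi => (h i hi).nonneg y, fun y σ τ hστ => ?_⟩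
  rw [← sum_sub_distrib, sum_mul]
  exact (abs_sum_le_sum_abs _ _).trans (sum_le_sum fun i hi => (h i hi).le y σ τ hστ)

/-! ### Torus facts: site incidence, polymers, multiplicities -/

section Torus

variable [NeZero L]

/-- Membership in `polymersThroughEdge` is membership of the base SITE (the tree's incidence). [folklore] -/
theorem mem_polymersThroughEdge_iff {X : Finset (Site d L)} {e : Edge d L} :
    X ∈ polymersThroughEdge e ↔ e.1 ∈ X := by
  simp only [polymersThroughEdge, mem_filter, mem_polymerEdges_iff, blockCorner_one, and_iff_right_iff_imp]
  intro _
  rw [mem_polymers_iff]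
  intro y _
  exact mem_image.2 ⟨y, mem_univ _, blockCorner_one y⟩

/-- Every site set is a polymer at block scale `1`. [folklore] -/
theorem mem_polymers_one (X : Finset (Site d L)) : X ∈ polymers (d := d) (L := L) 1 := by
  rw [mem_polymers_iff]
  intro y _
  exact mem_image.2 ⟨y, mem_univ _, blockCorner_one y⟩

/-- The multiplicities of a word sum to its length. [folklore] -/
theorem sum_mult_eq_length (w : List (Letter d L)) : ∑ y : Edge d L, mult w y = w.length := by
  induction w with
  | nil => simp
  | cons l w ih =>
    simp only [mult_cons, sum_add_distrib, ih, List.length_cons, sum_ite_eq, mem_univ, if_true]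

/-- **Base-point count**: exactly one base point `x` puts the letter `(x, k)` on a given link `e` (iff `k = e.2`).
[folklore] -/
theorem sum_ite_site_eq (k : Fin d) (e : Edge d L) :
    ∑ x : Site d L, (if (x, k) = e then (1 : ℕ) else 0) = if k = e.2 then 1 else 0 := by
  have : ∀ x : Site d L, ((x, k) = e) ↔ (x = e.1 ∧ k = e.2) := fun x => Prod.ext_iff
  simp_rw [this, ite_and]
  rw [sum_ite_eq']
  simp

end Torus

/-! ### Local terms -/

/-- A LOCAL TERM of a lattice action on the `SU(N)` torus: a gauge-invariant measurable bounded activity `act`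
reading the links of the list `letters` (based in the polymer `code`), with single-link oscillation witness
`oscC · mult letters e` and Frobenius-Lipschitz witness `lipC · mult letters e`. [folklore] -/
structure LocalTerm (d L N : ℕ) where
  /-- the activity -/
  act : GaugeConfig d L (SUN N) → ℝ
  /-- the links read, as letters (with multiplicity) -/
  letters : List (Letter d L)
  /-- the polymer carrying the term -/
  code : Finset (Site d L)
  /-- every letter is based in the code -/
  site_mem : ∀ l ∈ letters, l.site ∈ code
  /-- the activity reads only the letters' links -/
  dependsOn : DependsOn act (↑(wordEdges letters) : Set (Edge d L))
  /-- gauge invariance -/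
  gaugeInvariant : IsGaugeInvariant act
  /-- measurability -/
  measurable : Measurable act
  /-- a uniform bound -/
  bound : ℝ
  /-- the activity is bounded -/
  abs_le : ∀ U, |act U| ≤ bound
  /-- oscillation constant per letter -/
  oscC : ℝ
  /-- Frobenius-Lipschitz constant per letter -/
  lipC : ℝ
  /-- single-link oscillation witness -/
  isOscBound : Dobrushin.IsOscBound act fun e => oscC * mult letters e
  /-- single-link Frobenius-Lipschitz witness -/
  isLipBound : IsLipBound suFrobDist act fun e => lipC * mult letters e

namespace LocalTerm

/-- **The loop term** of a closed word `w` based at `x₀` with letters in `code`: activity `τ(1 − Re tr U_w/N)`,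
constants `oscC = 2|τ|`, `lipC = |τ|/√N` (`RobustBall/LoopActivity`). [folklore] -/
def ofLoop (N : ℕ) (τ : ℝ) (w : List (Letter d L)) (code : Finset (Site d L)) (x₀ : Site d L)
    (hw : IsWalk x₀ w x₀) (hcode : ∀ l ∈ w, l.site ∈ code) : LocalTerm d L N where
  act := loopActivity N τ w
  letters := w
  code := code
  site_mem := hcode
  dependsOn := dependsOn_loopActivity τ w
  gaugeInvariant := isGaugeInvariant_loopActivity hw τ
  measurable := measurable_loopActivity τ w
  bound := 2 * |τ|
  abs_le := abs_loopActivity_le τ w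
  oscC := 2 * |τ|
  lipC := |τ| / Real.sqrt N
  isOscBound := isOscBound_loopActivity τ w
  isLipBound := isLipBound_loopActivity τ w

/-- A link of positive multiplicity has its base site in the code. [folklore] -/
theorem fst_mem_code_of_mult_ne_zero (T : LocalTerm d L N) {e : Edge d L} (h : mult T.letters e ≠ 0) :
    e.1 ∈ T.code := by
  obtain ⟨l, hl, rfl⟩ := mem_wordEdges.1 (not_not.1 (mt mult_eq_zero_iff.2 h))
  exact T.site_mem l hl

/-- A per-term summand `c · mult(e)` vanishes unless `e.1 ∈ code`. [folklore] -/
theorem ite_mul_mult_eq (T : LocalTerm d L N) (c : ℝ) (e : Edge d L) :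
    (if e.1 ∈ T.code then c * (mult T.letters e : ℝ) else 0) = c * (mult T.letters e : ℝ) := by
  by_cases h : e.1 ∈ T.code
  · rw [if_pos h]
  · rw [if_neg h]
    by_cases hm : mult T.letters e = 0
    · rw [hm]; simp
    · exact absurd (T.fst_mem_code_of_mult_ne_zero hm) h

end LocalTerm

/-! ### The assembled perturbation of a finite family of local terms -/

section Family

variable [Fintype ι] (T : ι → LocalTerm d L N)

/-- The terms placed on the polymer `X`. [folklore] -/
def fiber (X : Finset (Site d L)) : Finset ι := univ.filter fun r => (T r).code = X

/-- Membership in a fiber. [folklore] -/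
@[simp] theorem mem_fiber {X : Finset (Site d L)} {r : ι} : r ∈ fiber T X ↔ (T r).code = X := by
  simp [fiber]

/-- With an injective code the fiber of `code r` is `{r}`. [folklore] -/
theorem fiber_code_eq (hinj : Function.Injective fun r => (T r).code) (r : ι) : fiber T (T r).code = {r} := by
  ext r'
  simp only [mem_fiber, mem_singleton]
  exact ⟨fun h => hinj h, fun h => h ▸ rfl⟩

variable [NeZero L]

/-- **The assembled perturbation**: polymer `X` carries `Σ_{code r = X} act_r`. [folklore] -/
def termPerturbation : Perturbation d L N where
  act X U := ∑ r ∈ fiber T X, (T r).act U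
  dependsOn' X := by
    intro U V h
    refine sum_congr rfl fun r hr => (T r).dependsOn fun e he => h e ?_
    obtain ⟨l, hl, rfl⟩ := mem_wordEdges.1 (Finset.mem_coe.1 he)
    have h1 : l.site ∈ X := (mem_fiber T).1 hr ▸ (T r).site_mem l hl
    exact Finset.mem_coe.2 (by simpa [Letter.edge] using h1)
  gaugeInvariant' X := fun g U => sum_congr rfl fun r _ => (T r).gaugeInvariant g U
  measurable' X := Finset.measurable_sum _ fun r _ => (T r).measurable
  bounded' X := ⟨∑ r ∈ fiber T X, (T r).bound, fun U =>
    (abs_sum_le_sum_abs _ _).trans (sum_le_sum fun r _ => (T r).abs_le U)⟩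

/-- The activities of the assembled perturbation. [folklore] -/
@[simp] theorem termPerturbation_act (X : Finset (Site d L)) (U : GaugeConfig d L (SUN N)) :
    (termPerturbation T).act X U = ∑ r ∈ fiber T X, (T r).act U := rfl

/-- **Total**: `W(U) = Σ_r act_r(U)`. [folklore] -/
theorem total_termPerturbation (U : GaugeConfig d L (SUN N)) :
    (termPerturbation T).total U = ∑ r, (T r).act U := by
  unfold QuasiLocalGaugePerturbation.total
  simp only [termPerturbation_act, fiber]
  exact sum_fiberwise_of_maps_to (fun r _ => mem_polymers_one (T r).code) _

/-- **Range**: codes of diameter `≤ R` give `HasRange R`. [folklore] -/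
theorem hasRange_termPerturbation {R : ℕ} (hR : ∀ r, polymerDiam (T r).code ≤ R) :
    HasRange R (termPerturbation T) := by
  intro X hX
  funext U
  simp only [termPerturbation_act, Pi.zero_apply]
  refine sum_eq_zero fun r hr => ?_
  have h1 := hR r
  rw [(mem_fiber T).1 hr] at h1
  exact absurd h1 (not_le.2 hX)

/-! ### The load witness and the loads under the tree's (site-based) incidence -/

/-- The LOAD WITNESS of the assembled perturbation: per-polymer sums of the one-link witnesses `oscC · mult`
(oscillation) and `lipC · mult` (Frobenius-Lipschitz). [folklore] -/
def termLoadWitness : LoadWitness (termPerturbation T) where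
  osc X e := ∑ r ∈ fiber T X, (T r).oscC * mult (T r).letters e
  lip X e := ∑ r ∈ fiber T X, (T r).lipC * mult (T r).letters e
  osc_spec X := isOscBound_sum (fiber T X) fun r _ => (T r).isOscBound
  lip_spec X := isLipBound_sum (fiber T X) fun r _ => (T r).isLipBound

/-- The oscillation witness, unfolded. [folklore] -/
@[simp] theorem termLoadWitness_osc (X : Finset (Site d L)) (e : Edge d L) :
    (termLoadWitness T).osc X e = ∑ r ∈ fiber T X, (T r).oscC * (mult (T r).letters e : ℝ) := rfl

/-- The Lipschitz witness, unfolded. [folklore] -/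
@[simp] theorem termLoadWitness_lip (X : Finset (Site d L)) (e : Edge d L) :
    (termLoadWitness T).lip X e = ∑ r ∈ fiber T X, (T r).lipC * (mult (T r).letters e : ℝ) := rfl

/-- Double sums over (polymers through the SITE `e.1`) × (fiber) collapse to a sum over the terms whose code
contains `e.1`. [folklore] -/
theorem sum_polymersThroughEdge_fiber (e : Edge d L) (g : ι → ℝ) :
    ∑ X ∈ polymersThroughEdge e, ∑ r ∈ fiber T X, g r = ∑ r, if e.1 ∈ (T r).code then g r else 0 := by
  simp only [fiber]
  rw [sum_fiberwise_eq_sum_filter, sum_filter]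
  refine sum_congr rfl fun r _ => ?_
  simp only [mem_polymersThroughEdge_iff]

/-- **Oscillation load** (site incidence): `a(e) = Σ_r oscC_r · mult_r(e)` — a term whose polymer contains the site
`e.1` but which does not read `e` contributes `0`. [folklore] -/
theorem oscLoad_eq (e : Edge d L) :
    (termLoadWitness T).oscLoad 0 e = ∑ r, (T r).oscC * (mult (T r).letters e : ℝ) := by
  simp only [LoadWitness.oscLoad, zero_mul, Real.exp_zero, one_mul, termLoadWitness_osc]
  rw [sum_polymersThroughEdge_fiber T e (fun r => (T r).oscC * (mult (T r).letters e : ℝ))]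
  exact sum_congr rfl fun r _ => (T r).ite_mul_mult_eq _ e

/-- **Self-Lipschitz load** (site incidence): `ℓ_s(e) = Σ_r lipC_r · mult_r(e)`. [folklore] -/
theorem selfLipLoad_eq (e : Edge d L) :
    (termLoadWitness T).selfLipLoad 0 e = ∑ r, (T r).lipC * (mult (T r).letters e : ℝ) := by
  simp only [LoadWitness.selfLipLoad, zero_mul, Real.exp_zero, one_mul, termLoadWitness_lip]
  rw [sum_polymersThroughEdge_fiber T e (fun r => (T r).lipC * (mult (T r).letters e : ℝ))]
  exact sum_congr rfl fun r _ => (T r).ite_mul_mult_eq _ e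

/-- **Cross-Lipschitz coefficient** (site incidence): `ℓ(e,y) = Σ_{r : e.1 ∈ code r} lipC_r · mult_r(y)` — EVERY term
whose polymer contains the site `e.1` is charged, whether or not it reads `e`. [folklore] -/
theorem crossLip_eq (e y : Edge d L) :
    (termLoadWitness T).crossLip 0 e y =
      ∑ r, if e.1 ∈ (T r).code then (T r).lipC * (mult (T r).letters y : ℝ) else 0 := by
  simp only [LoadWitness.crossLip, zero_mul, Real.exp_zero, one_mul, termLoadWitness_lip]
  have step : ∀ X ∈ polymersThroughEdge e,
      (if y ∈ polymerEdges 1 X then ∑ r ∈ fiber T X, (T r).lipC * (mult (T r).letters y : ℝ) else 0) =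
        ∑ r ∈ fiber T X, (T r).lipC * (mult (T r).letters y : ℝ) := by
    intro X _
    split_ifs with hy
    · rfl
    · refine (sum_eq_zero fun r hr => ?_).symm
      by_cases hm : mult (T r).letters y = 0
      · rw [hm]; simp
      · have h1 : y.1 ∈ X := (mem_fiber T).1 hr ▸ (T r).fst_mem_code_of_mult_ne_zero hm
        exact absurd (by simpa using h1) hy
  rw [sum_filter, sum_congr rfl step,
    sum_polymersThroughEdge_fiber T e (fun r => (T r).lipC * (mult (T r).letters y : ℝ))]

/-- **Total Lipschitz load** (site incidence): `ℓ_s(e) + Λ(e) = Σ_{r : e.1 ∈ code r} lipC_r · |letters_r|` — the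
Lipschitz mass of EVERY term whose polymer contains the SITE `e.1`. [folklore] -/
theorem selfLipLoad_add_crossLipLoad_eq (e : Edge d L) :
    (termLoadWitness T).selfLipLoad 0 e + (termLoadWitness T).crossLipLoad 0 e =
      ∑ r, if e.1 ∈ (T r).code then (T r).lipC * ((T r).letters.length : ℝ) else 0 := by
  rw [selfLipLoad_eq, LoadWitness.crossLipLoad]
  simp only [crossLip_eq]
  rw [sum_comm, ← sum_add_distrib]
  refine sum_congr rfl fun r _ => ?_
  by_cases h : e.1 ∈ (T r).code
  · simp only [if_pos h, ← mul_sum, ← mul_add]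
    congr 1
    rw [Finset.add_sum_erase univ (fun y => (mult (T r).letters y : ℝ)) (mem_univ e)]
    exact_mod_cast sum_mult_eq_length (T r).letters
  · simp only [if_neg h, sum_const_zero, add_zero]
    by_cases hm : mult (T r).letters e = 0
    · rw [hm]; simp
    · exact absurd ((T r).fst_mem_code_of_mult_ne_zero hm) h

/-- **Membership in the tier-1 ball from two counts** (site incidence): if every code has diameter `≤ R`,
`Σ_r oscC_r · mult_r(e) ≤ ε₀` and `Σ_{r : e.1 ∈ code r} lipC_r · |letters_r| ≤ ε₁` at every link `e`, then the
assembled perturbation lies in `ClusterDomainFR ε₀ ε₁ R`. [folklore] -/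
theorem termPerturbation_mem_clusterDomainFR {R : ℕ} {ε₀ ε₁ : ℝ} (hR : ∀ r, polymerDiam (T r).code ≤ R)
    (h₀ : ∀ e : Edge d L, ∑ r, (T r).oscC * (mult (T r).letters e : ℝ) ≤ ε₀)
    (h₁ : ∀ e : Edge d L, ∑ r, (if e.1 ∈ (T r).code then (T r).lipC * ((T r).letters.length : ℝ) else 0) ≤ ε₁) :
    termPerturbation T ∈ ClusterDomainFR ε₀ ε₁ R := by
  refine ⟨hasRange_termPerturbation T hR, termLoadWitness T, fun e => ?_, fun e => ?_⟩
  · rw [oscLoad_eq]; exact h₀ e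
  · rw [selfLipLoad_add_crossLipLoad_eq]; exact h₁ e

/-! ### Vertical windows and centre-slab invariance -/

/-- **Vertical dependence diameter** from an INJECTIVE code and per-term windows: if the `v`-letters of every term
sit at `m` consecutive `v`-heights, the assembled perturbation has `HasVertRange m`. [folklore] -/
theorem hasVertRange_termPerturbation {m : ℕ} (hinj : Function.Injective fun r => (T r).code)
    (hwin : ∀ r (v : Fin d), ∃ t₀ : ZMod L, ∀ l ∈ (T r).letters, l.dir = v → ∃ k : ℕ, k < m ∧ l.site v = t₀ + k) :
    HasVertRange m (termPerturbation T) := by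
  intro X v
  by_cases hX : ∃ r, (T r).code = X
  · obtain ⟨r, rfl⟩ := hX
    obtain ⟨t₀, ht₀⟩ := hwin r v
    refine ⟨t₀, fun U V h => ?_⟩
    simp only [termPerturbation_act]
    refine sum_congr rfl fun r' hr' => ?_
    obtain rfl : r' = r := hinj ((mem_fiber T).1 hr')
    refine (T r').dependsOn fun e he => h e ?_
    obtain ⟨l, hl, rfl⟩ := mem_wordEdges.1 (Finset.mem_coe.1 he)
    by_cases hv : l.dir = v
    · obtain ⟨k, hk, hkt⟩ := ht₀ l hl hv
      exact Or.inr ⟨k, hk, hkt⟩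
    · exact Or.inl hv
  · refine ⟨0, fun U V _ => ?_⟩
    simp only [termPerturbation_act]
    rw [sum_eq_zero fun r hr => ?_, sum_eq_zero fun r hr => ?_] <;>
      exact absurd ⟨r, (mem_fiber T).1 hr⟩ hX

/-- **Vertical dependence diameter from the CODES alone** (no injectivity): if every code sits, in every direction
`v`, at `m` consecutive `v`-heights, the assembled perturbation has `HasVertRange m` (all letters are based in the
code). [folklore] -/
theorem hasVertRange_termPerturbation_of_code {m : ℕ}
    (hwin : ∀ r (v : Fin d), ∃ t₀ : ZMod L, ∀ p ∈ (T r).code, ∃ k : ℕ, k < m ∧ p v = t₀ + k) :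
    HasVertRange m (termPerturbation T) := by
  intro X v
  by_cases hX : ∃ r, (T r).code = X
  · obtain ⟨r, rfl⟩ := hX
    obtain ⟨t₀, ht₀⟩ := hwin r v
    refine ⟨t₀, fun U V h => ?_⟩
    simp only [termPerturbation_act]
    refine sum_congr rfl fun r' hr' => (T r').dependsOn fun e he => h e ?_
    obtain ⟨l, hl, rfl⟩ := mem_wordEdges.1 (Finset.mem_coe.1 he)
    obtain ⟨k, hk, hkt⟩ := ht₀ l.site ((mem_fiber T).1 hr' ▸ (T r').site_mem l hl)
    exact Or.inr ⟨k, hk, hkt⟩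
  · refine ⟨0, fun U V _ => ?_⟩
    simp only [termPerturbation_act]
    rw [sum_eq_zero fun r hr => ?_, sum_eq_zero fun r hr => ?_] <;>
      exact absurd ⟨r, (mem_fiber T).1 hr⟩ hX

/-- **Centre-slab invariance of the total** from centre-invariant terms. [folklore] -/
theorem total_centerSlabRotate
    (hc : ∀ r (v : Fin d) (t : ZMod L) (z : SUN N), z ∈ Subgroup.center (SUN N) →
      ∀ U, (T r).act (centerSlabRotate v t z U) = (T r).act U)
    (v : Fin d) (t : ZMod L) {z : SUN N} (hz : z ∈ Subgroup.center (SUN N)) (U : GaugeConfig d L (SUN N)) :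
    (termPerturbation T).total (centerSlabRotate v t z U) = (termPerturbation T).total U := by
  rw [total_termPerturbation, total_termPerturbation]
  exact sum_congr rfl fun r _ => hc r v t z hz U

/-- **`IsSlabLocal m`** of the assembled perturbation: centre-invariant terms, injective code, per-term windows.
[folklore] -/
theorem isSlabLocal_termPerturbation {m : ℕ}
    (hc : ∀ r (v : Fin d) (t : ZMod L) (z : SUN N), z ∈ Subgroup.center (SUN N) →
      ∀ U, (T r).act (centerSlabRotate v t z U) = (T r).act U)
    (hinj : Function.Injective fun r => (T r).code)
    (hwin : ∀ r (v : Fin d), ∃ t₀ : ZMod L, ∀ l ∈ (T r).letters, l.dir = v → ∃ k : ℕ, k < m ∧ l.site v = t₀ + k) :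
    IsSlabLocal m (termPerturbation T) :=
  ⟨fun v t _ hz U => total_centerSlabRotate T hc v t hz U, hasVertRange_termPerturbation T hinj hwin⟩

/-- **`IsSlabLocal m`** from centre-invariant terms and code windows (no injectivity). [folklore] -/
theorem isSlabLocal_termPerturbation_of_code {m : ℕ}
    (hc : ∀ r (v : Fin d) (t : ZMod L) (z : SUN N), z ∈ Subgroup.center (SUN N) →
      ∀ U, (T r).act (centerSlabRotate v t z U) = (T r).act U)
    (hwin : ∀ r (v : Fin d), ∃ t₀ : ZMod L, ∀ p ∈ (T r).code, ∃ k : ℕ, k < m ∧ p v = t₀ + k) :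
    IsSlabLocal m (termPerturbation T) :=
  ⟨fun v t _ hz U => total_centerSlabRotate T hc v t hz U, hasVertRange_termPerturbation_of_code T hwin⟩

end Family

end Summit.Ventures.YMGap.RobustBall

end
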